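import Mathlib
import Summits.ValiantsHypothesis.ValiantsHypothesis.Theorems.BarrierLeverPartitionMinorsHitByVPSimplexJoinBoxGameLayerCake

/-!
# Route BarrierLever — item `PartitionMinorsHitByVP` (stmt-ValiantsHypothesis-19717), line `hidden_states`:
# THE DIMENSION LAW OF THE BOX GAME FOR EVERY `t` — by a linear-algebra transfer, for both demand floors

Helper file (`--supports stmt-ValiantsHypothesis-19717`; cell valiant-natproofs, rung V4, 𝒟-side door (c), line
`Cruxes/PartitionMinorsHitByVP/Lines/hidden_states.lean` v8, registered stub `stub_simplexPairLower`; prover seat val-np-p3 gen 15).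
Definition-free. Closes NO item.

THE POINT. The box game of p647518 (crude demand floor `⌊(r−2)/hd⌋+1`) and p656478 (layer-cake floor) CERTIFIES: every position
`W hd r e` of a winning predicate `W` is good for EVERY injective lower row family on `hd` coordinates
(`exists_simplexTable_of_boxWinning[_layerCake]`). Read contrapositively this is a TRANSFER PRINCIPLE
(`not_boxWinning_of_singular[_layerCake]`): to show that NO winning predicate contains a position `e` at `(hd, r)` it suffices to exhibit
ONE injective lower family `u` of size `r` on `hd` coordinates against which the simplex matrix of `e` is singular for every table — a
statement of linear algebra, with no adversary strategy and no induction on `r`.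

THE LAW (`det_simplexMatrix_eq_zero_of_cube`, `not_boxWinning_hypercube`, `not_boxWinning_hypercube_layerCake`). If `e` contains, inside ONE
piece, an injective binary `(t+1)`-cube of columns `i : (Fin (t+1) → Fin 2) → Fin r` each of whose slots reads a single cube coordinate, then
against ANY row family whose members have size `≤ t` the alternating column combination `Σ_z (−1)^{|z|} col(i z)` vanishes: the entry of row
`u` at column `i z` is the value at the 0/1-point `z` of a polynomial of total degree `≤ |u| ≤ t` in the `t+1` cube coordinates (each factor
`tx p none a + Σ_f (slot-f value at z_{c f})` is affine in `z`), and the alternating sum over `{0,1}^{t+1}` of a polynomial of total degree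
`< t+1` is zero (`altSum_eval_eq_zero`: every monomial misses a coordinate). Injective lower families of `r` sets of size `≤ t` exist exactly
when `r ≤ B_t(hd) = Σ_{j ≤ t} C(hd, j)` (`exists_lower_family_card_le`: trim the radius-`t` Hamming ball, a down-set, to size `r` by removing
maximal members). Hence for EVERY
`W` satisfying either box-game hypothesis: `¬ W hd r e` whenever `r ≤ B_t(hd)` and `e` contains such a cube — val-np-p3 g14's typed target
`not_boxWinning_hypercube_TARGET` (HOME/val-np-p3/g14/lean/BoxGameDimLawSketch.lean) for ALL `t`, WITHOUT its side condition
`2(t+1)² ≤ hd` and without `1 ≤ hd`; the landed cases `t = 1` (p658056 `not_boxWinning_rect[_layerCake]`) and `t = 2` (p658496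
`not_boxWinning_cube`, p659328 `not_boxWinning_cube_layerCake`) are the instances `t = 1, 2` up to the indexing of the cube.

WHAT THIS IS NOT: a NECESSARY condition on winning predicates, not a winning predicate; `Stmt.simplexPairLower` and item 19717 stay OPEN;
nothing on crux 14610 or VP ≠ VNP.
-/

set_option linter.dupNamespace false

namespace Summit.ValiantsHypothesis.ValiantsHypothesis.Theorems.BarrierLever.SimplexJoin.Cut

open Finset Matrix MvPolynomial
open Summit.ValiantsHypothesis.ValiantsHypothesis.Theorems.BarrierLever.HiddenStates

noncomputable section

/-! ## 1. Alternating sums of low-degree polynomials over the Boolean cube vanish -/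

/-- A monomial missing the coordinate `c₀` has alternating sum zero over `{0,1}^n` (the `c₀`-factor of the product formula is `1 − 1`). -/
theorem altSum_prod_pow_eq_zero {R : Type*} [CommRing R] {n : ℕ} (d : Fin n → ℕ) (c₀ : Fin n) (hc₀ : d c₀ = 0) :
    ∑ z : Fin n → Fin 2, (∏ c, (if z c = 1 then (-1 : R) else 1)) * ∏ c, (if z c = 1 then (1 : R) else 0) ^ d c = 0 := by
  classical
  set g : Fin n → Fin 2 → R := fun c b => (if b = 1 then (-1 : R) else 1) * (if b = 1 then (1 : R) else 0) ^ d c with hg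
  have hterm : ∀ z : Fin n → Fin 2,
      (∏ c, (if z c = 1 then (-1 : R) else 1)) * ∏ c, (if z c = 1 then (1 : R) else 0) ^ d c = ∏ c, g c (z c) := by
    intro z
    rw [hg, ← Finset.prod_mul_distrib]
  simp_rw [hterm]
  rw [← Fintype.prod_sum g]
  refine Finset.prod_eq_zero (Finset.mem_univ c₀) ?_
  rw [Fin.sum_univ_two, hg]
  simp [hc₀]

/-- **Alternating sums kill low degree.** For a polynomial `P` in `n` variables of total degree `< n`,
`Σ_{z ∈ {0,1}^n} (−1)^{|z|} P(z) = 0`. -/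
theorem altSum_eval_eq_zero {R : Type*} [CommRing R] {n : ℕ} (P : MvPolynomial (Fin n) R) (hP : P.totalDegree < n) :
    ∑ z : Fin n → Fin 2, (∏ c, (if z c = 1 then (-1 : R) else 1)) *
      MvPolynomial.eval (fun c => if z c = 1 then (1 : R) else 0) P = 0 := by
  classical
  simp_rw [MvPolynomial.eval_eq' _ P, Finset.mul_sum]
  rw [Finset.sum_comm]
  refine Finset.sum_eq_zero fun d hd => ?_
  -- the monomial `d` misses a coordinate
  have hc : ∃ c₀, d c₀ = 0 := by
    by_contra hno
    push Not at hno
    have hdeg := MvPolynomial.le_totalDegree hd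
    have hn : n ≤ d.sum fun _ e => e := by
      rw [Finsupp.sum_fintype _ _ (fun _ => rfl)]
      calc n = ∑ _c : Fin n, 1 := by simp
        _ ≤ ∑ c, d c := Finset.sum_le_sum fun c _ => Nat.one_le_iff_ne_zero.mpr (hno c)
    omega
  obtain ⟨c₀, hc₀⟩ := hc
  have hfac : ∑ z : Fin n → Fin 2, (∏ c, (if z c = 1 then (-1 : R) else 1)) *
        (P.coeff d * ∏ c, (if z c = 1 then (1 : R) else 0) ^ d c)
      = P.coeff d * ∑ z : Fin n → Fin 2, (∏ c, (if z c = 1 then (-1 : R) else 1)) *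
          ∏ c, (if z c = 1 then (1 : R) else 0) ^ d c := by
    rw [Finset.mul_sum]
    exact Finset.sum_congr rfl fun z _ => by ring
  rw [hfac, altSum_prod_pow_eq_zero d c₀ hc₀, mul_zero]

/-! ## 2. A binary `(t+1)`-cube in one piece is singular against rows of size `≤ t` -/

/-- **The singular configuration.** Let the simplex column data `e` contain an injective binary `(t+1)`-cube `i` inside one piece,
each slot reading one cube coordinate (`(e (i z)).2 φ` depends only on `z (c φ)`), and let every row have size `≤ t`. Then for EVERY
table the simplex matrix `[∏_{a ∈ u row} (tx p none a + Σ_f value_f)]` is singular: the vector `z ↦ (−1)^{|z|}` on the cube columns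
is in its kernel. -/
theorem det_simplexMatrix_eq_zero_of_cube {m D N h r t : ℕ}
    (u : Fin r → Finset (Fin h)) (hut : ∀ row, (u row).card ≤ t)
    (e : Fin r → Fin m × (Fin D → Option (Fin N))) (i : (Fin (t + 1) → Fin 2) → Fin r)
    (hinj : Function.Injective i)
    (hpiece : ∀ z, (e (i z)).1 = (e (i fun _ => 0)).1)
    (hcube : ∀ φ : Fin D, ∃ c : Fin (t + 1), ∀ z z', z c = z' c → (e (i z)).2 φ = (e (i z')).2 φ)
    (tx : Fin m → Option (Fin D × Fin N) → Fin h → ℂ) :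
    (Matrix.of fun row k : Fin r => ∏ a ∈ u row,
      (tx (e k).1 none a + ∑ f : Fin D, ((e k).2 f).elim 0 fun j => tx (e k).1 (some (f, j)) a)).det = 0 := by
  classical
  set M : Matrix (Fin r) (Fin r) ℂ := Matrix.of fun row k : Fin r => ∏ a ∈ u row,
      (tx (e k).1 none a + ∑ f : Fin D, ((e k).2 f).elim 0 fun j => tx (e k).1 (some (f, j)) a) with hM
  set p : Fin m := (e (i fun _ => 0)).1 with hp
  choose c hc using hcube
  -- slot values as functions of one bit
  let sv : Fin D → Fin 2 → Fin h → ℂ := fun f b a => ((e (i fun _ => b)).2 f).elim 0 fun j => tx p (some (f, j)) a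
  have hsv : ∀ z f a, (((e (i z)).2 f).elim 0 fun j => tx p (some (f, j)) a) = sv f (z (c f)) a := by
    intro z f a
    have hzf : (e (i z)).2 f = (e (i fun _ => z (c f))).2 f := hc f z (fun _ => z (c f)) rfl
    simp only [sv, hzf]
  -- the affine polynomial of coordinate `a` in the cube coordinates
  let ℓ : Fin h → MvPolynomial (Fin (t + 1)) ℂ := fun a =>
    C (tx p none a) + ∑ f : Fin D, (C (sv f 0 a) + C (sv f 1 a - sv f 0 a) * X (c f))
  have hℓdeg : ∀ a, (ℓ a).totalDegree ≤ 1 := by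
    intro a
    refine (totalDegree_add _ _).trans (max_le (by rw [totalDegree_C]; exact Nat.zero_le _) ?_)
    refine totalDegree_finsetSum_le fun f _ => ?_
    refine (totalDegree_add _ _).trans (max_le (by rw [totalDegree_C]; exact Nat.zero_le _) ?_)
    refine (totalDegree_mul _ _).trans ?_
    rw [totalDegree_C, totalDegree_X, zero_add]
  have hℓeval : ∀ (z : Fin (t + 1) → Fin 2) a,
      MvPolynomial.eval (fun c' => if z c' = 1 then (1 : ℂ) else 0) (ℓ a) = tx p none a + ∑ f : Fin D, sv f (z (c f)) a := by
    intro z a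
    simp only [ℓ, map_add, map_sum, map_mul, eval_C, eval_X]
    congr 1
    refine Finset.sum_congr rfl fun f _ => ?_
    rcases Fin.exists_fin_two.mp ⟨z (c f), rfl⟩ with h0 | h1
    · rw [h0]; simp
    · rw [h1]; simp
  -- the row polynomials
  let Q : Fin r → MvPolynomial (Fin (t + 1)) ℂ := fun row => ∏ a ∈ u row, ℓ a
  have hQdeg : ∀ row, (Q row).totalDegree < t + 1 := by
    intro row
    refine Nat.lt_succ_of_le ?_
    calc (Q row).totalDegree ≤ ∑ a ∈ u row, (ℓ a).totalDegree := totalDegree_finsetProd _ _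
      _ ≤ ∑ a ∈ u row, 1 := Finset.sum_le_sum fun a _ => hℓdeg a
      _ = (u row).card := by simp
      _ ≤ t := hut row
  have hQeval : ∀ row (z : Fin (t + 1) → Fin 2),
      MvPolynomial.eval (fun c' => if z c' = 1 then (1 : ℂ) else 0) (Q row) = M row (i z) := by
    intro row z
    rw [hM, Matrix.of_apply, map_prod]
    refine Finset.prod_congr rfl fun a _ => ?_
    rw [hℓeval, hpiece z]
    congr 1
    exact Finset.sum_congr rfl fun f _ => (hsv z f a).symm
  -- the kernel vector: `(−1)^{|z|}` on the cube column `i z`, zero elsewhere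
  let sgn : (Fin (t + 1) → Fin 2) → ℂ := fun z => ∏ c', (if z c' = 1 then (-1 : ℂ) else 1)
  let v : Fin r → ℂ := fun k => ∑ z ∈ Finset.univ.filter (fun z => i z = k), sgn z
  have hv : v ≠ 0 := by
    intro hv0
    have h0 := congrFun hv0 (i fun _ => 0)
    have hfil : (Finset.univ.filter fun z : Fin (t + 1) → Fin 2 => i z = i fun _ => 0) = {fun _ => 0} := by
      ext z
      simp only [Finset.mem_filter, Finset.mem_univ, true_and, Finset.mem_singleton]
      exact ⟨fun hz => hinj hz, fun hz => by rw [hz]⟩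
    simp only [v, hfil, Finset.sum_singleton, sgn, Pi.zero_apply] at h0
    simp at h0
  apply Matrix.exists_mulVec_eq_zero_iff.mp
  refine ⟨v, hv, ?_⟩
  funext row
  rw [Pi.zero_apply, Matrix.mulVec, dotProduct]
  calc ∑ k, M row k * v k
      = ∑ k, ∑ z ∈ Finset.univ.filter (fun z => i z = k), M row (i z) * sgn z := by
        refine Finset.sum_congr rfl fun k _ => ?_
        rw [Finset.mul_sum]
        exact Finset.sum_congr rfl fun z hz => by rw [(Finset.mem_filter.mp hz).2]
    _ = ∑ z, M row (i z) * sgn z := Finset.sum_fiberwise Finset.univ i (fun z => M row (i z) * sgn z)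
    _ = ∑ z : Fin (t + 1) → Fin 2, sgn z *
          MvPolynomial.eval (fun c' => if z c' = 1 then (1 : ℂ) else 0) (Q row) := by
        refine Finset.sum_congr rfl fun z _ => ?_
        rw [hQeval, mul_comm]
    _ = 0 := altSum_eval_eq_zero (Q row) (hQdeg row)

/-- The same law in the encoded symbolic calculus of the cut game: `symDet u (enc ∘ e) = 0`. -/
theorem symDet_enc_eq_zero_of_cube {m D N h r t : ℕ}
    (u : Fin r → Finset (Fin h)) (hut : ∀ row, (u row).card ≤ t)
    (e : Fin r → Fin m × (Fin D → Option (Fin N))) (i : (Fin (t + 1) → Fin 2) → Fin r)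
    (hinj : Function.Injective i)
    (hpiece : ∀ z, (e (i z)).1 = (e (i fun _ => 0)).1)
    (hcube : ∀ φ : Fin D, ∃ c : Fin (t + 1), ∀ z z', z c = z' c → (e (i z)).2 φ = (e (i z')).2 φ) :
    SymbJoin.symDet u (fun k => enc (e k)) = 0 := by
  by_contra hne
  obtain ⟨tx, htx⟩ := exists_simplexTable_of_symGood u e hne
  exact htx (det_simplexMatrix_eq_zero_of_cube u hut e i hinj hpiece hcube tx)

/-! ## 3. Small lower families exist below the ball -/

/-- The number of subsets of `Fin n` of size `≤ t` is `B_t(n) = Σ_{j ≤ t} C(n, j)`. -/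
theorem card_filter_card_le (n t : ℕ) :
    (Finset.univ.filter fun J : Finset (Fin n) => J.card ≤ t).card = ∑ j ∈ Finset.range (t + 1), n.choose j := by
  have hdecomp : (Finset.univ.filter fun J : Finset (Fin n) => J.card ≤ t) =
      (Finset.range (t + 1)).biUnion fun j => Finset.powersetCard j (Finset.univ : Finset (Fin n)) := by
    ext J
    simp only [Finset.mem_filter, Finset.mem_univ, true_and, Finset.mem_biUnion, Finset.mem_range,
      Finset.mem_powersetCard, Finset.subset_univ]
    constructor
    · intro hJ; exact ⟨J.card, by omega, rfl⟩
    · rintro ⟨j, hj, hJ⟩; omega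
  rw [hdecomp, Finset.card_biUnion]
  · simp only [Finset.card_powersetCard, Finset.card_univ, Fintype.card_fin]
  · exact (Finset.pairwise_disjoint_powersetCard _).set_pairwise _

/-- **Trimming.** A down-closed finite family of finsets has a down-closed subfamily of every size below its own (remove a member of
maximal cardinality — it is a maximal member — and recurse). -/
theorem exists_lower_subfamily_card {α : Type*} [DecidableEq α] (d : ℕ) :
    ∀ (L : Finset (Finset α)), IsLowerSet (↑L : Set (Finset α)) → ∀ k, L.card = k + d →
      ∃ L' : Finset (Finset α), L' ⊆ L ∧ L'.card = k ∧ IsLowerSet (↑L' : Set (Finset α)) := by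
  induction d with
  | zero => intro L hL k hk; exact ⟨L, subset_rfl, by simpa using hk, hL⟩
  | succ d ih =>
    intro L hL k hk
    have hne : L.Nonempty := by rw [← Finset.card_pos]; omega
    obtain ⟨S₀, hS₀, hmax⟩ := Finset.exists_max_image L Finset.card hne
    have hL' : IsLowerSet (↑(L.erase S₀) : Set (Finset α)) := by
      intro S T hTS hS
      rw [Finset.mem_coe, Finset.mem_erase] at hS ⊢
      refine ⟨?_, hL hTS hS.2⟩
      rintro rfl
      exact hS.1 (Finset.eq_of_subset_of_card_le hTS (hmax S hS.2)).symm
    obtain ⟨L', hsub, hcard, hlow⟩ := ih (L.erase S₀) hL' k (by rw [Finset.card_erase_of_mem hS₀]; omega)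
    exact ⟨L', hsub.trans (Finset.erase_subset _ _), hcard, hlow⟩

/-- **Small lower families exist**: for `r ≤ B_t(n)` there is an injective LOWER family of `r` subsets of `Fin n` all of size `≤ t`
(a down-closed subfamily of the radius-`t` Hamming ball). -/
theorem exists_lower_family_card_le (n t r : ℕ) (hr : r ≤ ∑ j ∈ Finset.range (t + 1), n.choose j) :
    ∃ u : Fin r → Finset (Fin n), Function.Injective u ∧ IsLowerSet (Set.range u) ∧ ∀ i, (u i).card ≤ t := by
  classical
  set B : Finset (Finset (Fin n)) := Finset.univ.filter fun J => J.card ≤ t with hB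
  have hBlow : IsLowerSet (↑B : Set (Finset (Fin n))) := by
    intro S T hTS hS
    rw [Finset.mem_coe, hB, Finset.mem_filter] at hS ⊢
    exact ⟨Finset.mem_univ _, (Finset.card_le_card hTS).trans hS.2⟩
  have hrB : r ≤ B.card := by rw [hB, card_filter_card_le]; exact hr
  obtain ⟨L, hLB, hLcard, hLlow⟩ := exists_lower_subfamily_card (B.card - r) B hBlow r (by omega)
  let φ : (L : Type) ≃ Fin r := Finset.equivFinOfCardEq hLcard
  let u : Fin r → Finset (Fin n) := fun i => (φ.symm i).1
  have hrange : Set.range u = (↑L : Set (Finset (Fin n))) := by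
    ext J
    constructor
    · rintro ⟨i, rfl⟩
      exact (φ.symm i).2
    · intro hJ
      refine ⟨φ ⟨J, hJ⟩, ?_⟩
      simp only [u, Equiv.symm_apply_apply]
  refine ⟨u, ?_, ?_, ?_⟩
  · intro i j hij
    exact φ.symm.injective (Subtype.ext hij)
  · rw [hrange]; exact hLlow
  · intro i
    have hmem : u i ∈ B := hLB (φ.symm i).2
    rw [hB, Finset.mem_filter] at hmem
    exact hmem.2

/-! ## 4. The transfer principle and the dimension law, crude floor (p647518) -/

/-- **TRANSFER (crude floor).** A position that is singular, for every table, against SOME injective lower row family on `hd`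
coordinates belongs to NO box-game winning predicate. -/
theorem not_boxWinning_of_singular {m D N : ℕ}
    (W : (hd : ℕ) → (r : ℕ) → (Fin r → Fin m × (Fin D → Option (Fin N))) → Prop)
    (hwin : ∀ (hd r : ℕ) (e : Fin r → Fin m × (Fin D → Option (Fin N))), W hd r e → 2 ≤ r → 1 ≤ hd →
      ∀ r₀ r₁ : ℕ, r₀ + r₁ = r → (r - 2) / hd + 1 ≤ r₁ → r₁ ≤ r₀ → r₀ ≤ 2 ^ (hd - 1) →
        ∃ (f : Fin m → Fin D) (side : Fin m → Option (Fin N) → Bool) (g₀ : Fin r₀ → Fin r) (g₁ : Fin r₁ → Fin r),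
          Function.Injective (Sum.elim g₀ g₁) ∧
          (∀ j, side (e (g₀ j)).1 ((e (g₀ j)).2 (f (e (g₀ j)).1)) = false) ∧
          (∀ j, side (e (g₁ j)).1 ((e (g₁ j)).2 (f (e (g₁ j)).1)) = true) ∧
          W (hd - 1) r₀ (fun j => e (g₀ j)) ∧ W (hd - 1) r₁ (fun j => e (g₁ j)))
    (hd r : ℕ) (e : Fin r → Fin m × (Fin D → Option (Fin N)))
    (u : Fin r → Finset (Fin hd)) (hu : Function.Injective u) (hlow : IsLowerSet (Set.range u))
    (hsing : ∀ tx : Fin m → Option (Fin D × Fin N) → Fin hd → ℂ,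
      (Matrix.of fun row k : Fin r => ∏ a ∈ u row,
        (tx (e k).1 none a + ∑ f : Fin D, ((e k).2 f).elim 0 fun j => tx (e k).1 (some (f, j)) a)).det = 0) :
    ¬ W hd r e := by
  intro hW
  obtain ⟨tx, htx⟩ := exists_simplexTable_of_boxWinning W hwin e hW u hu hlow
  exact htx (hsing tx)

/-- **THE DIMENSION LAW, every `t` (crude floor).** For every box-game winning predicate `W`: if `r ≤ B_t(hd)` and the position `e`
contains, inside one piece, an injective binary `(t+1)`-cube of columns each of whose slots reads one cube coordinate, then `¬ W hd r e`.
(val-np-p3 g14's `not_boxWinning_hypercube_TARGET` for all `t`, without the side conditions `2(t+1)² ≤ hd`, `1 ≤ hd`; `t = 1, 2` are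
p658056 / p658496 up to the indexing of the cube.) -/
theorem not_boxWinning_hypercube {m D N : ℕ}
    (W : (hd : ℕ) → (r : ℕ) → (Fin r → Fin m × (Fin D → Option (Fin N))) → Prop)
    (hwin : ∀ (hd r : ℕ) (e : Fin r → Fin m × (Fin D → Option (Fin N))), W hd r e → 2 ≤ r → 1 ≤ hd →
      ∀ r₀ r₁ : ℕ, r₀ + r₁ = r → (r - 2) / hd + 1 ≤ r₁ → r₁ ≤ r₀ → r₀ ≤ 2 ^ (hd - 1) →
        ∃ (f : Fin m → Fin D) (side : Fin m → Option (Fin N) → Bool) (g₀ : Fin r₀ → Fin r) (g₁ : Fin r₁ → Fin r),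
          Function.Injective (Sum.elim g₀ g₁) ∧
          (∀ j, side (e (g₀ j)).1 ((e (g₀ j)).2 (f (e (g₀ j)).1)) = false) ∧
          (∀ j, side (e (g₁ j)).1 ((e (g₁ j)).2 (f (e (g₁ j)).1)) = true) ∧
          W (hd - 1) r₀ (fun j => e (g₀ j)) ∧ W (hd - 1) r₁ (fun j => e (g₁ j)))
    (t : ℕ) :
    ∀ (r hd : ℕ) (e : Fin r → Fin m × (Fin D → Option (Fin N))) (i : (Fin (t + 1) → Fin 2) → Fin r),
      r ≤ ∑ j ∈ Finset.range (t + 1), hd.choose j → Function.Injective i →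
      (∀ z, (e (i z)).1 = (e (i fun _ => 0)).1) →
      (∀ φ : Fin D, ∃ c : Fin (t + 1), ∀ z z', z c = z' c → (e (i z)).2 φ = (e (i z')).2 φ) →
      ¬ W hd r e := by
  intro r hd e i hr hinj hpiece hcube
  obtain ⟨u, hu, hlow, hut⟩ := exists_lower_family_card_le hd t r hr
  exact not_boxWinning_of_singular W hwin hd r e u hu hlow
    (fun tx => det_simplexMatrix_eq_zero_of_cube u hut e i hinj hpiece hcube tx)

/-! ## 5. The transfer principle and the dimension law, layer-cake floor (p656478) -/

/-- **TRANSFER (layer-cake floor).** As `not_boxWinning_of_singular`, for winning predicates of the sharp-floor box game. -/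
theorem not_boxWinning_of_singular_layerCake {m D N : ℕ}
    (W : (hd : ℕ) → (r : ℕ) → (Fin r → Fin m × (Fin D → Option (Fin N))) → Prop)
    (hwin : ∀ (hd r : ℕ) (e : Fin r → Fin m × (Fin D → Option (Fin N))), W hd r e → 2 ≤ r → 1 ≤ hd →
      ∀ r₀ r₁ : ℕ, r₀ + r₁ = r →
        (∑ d ∈ Finset.range hd, (r - ∑ j ∈ Finset.range (d + 1), hd.choose j) + hd - 1) / hd ≤ r₁ → r₁ ≤ r₀ →
        r₀ ≤ 2 ^ (hd - 1) →
        ∃ (f : Fin m → Fin D) (side : Fin m → Option (Fin N) → Bool) (g₀ : Fin r₀ → Fin r) (g₁ : Fin r₁ → Fin r),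
          Function.Injective (Sum.elim g₀ g₁) ∧
          (∀ j, side (e (g₀ j)).1 ((e (g₀ j)).2 (f (e (g₀ j)).1)) = false) ∧
          (∀ j, side (e (g₁ j)).1 ((e (g₁ j)).2 (f (e (g₁ j)).1)) = true) ∧
          W (hd - 1) r₀ (fun j => e (g₀ j)) ∧ W (hd - 1) r₁ (fun j => e (g₁ j)))
    (hd r : ℕ) (e : Fin r → Fin m × (Fin D → Option (Fin N)))
    (u : Fin r → Finset (Fin hd)) (hu : Function.Injective u) (hlow : IsLowerSet (Set.range u))
    (hsing : ∀ tx : Fin m → Option (Fin D × Fin N) → Fin hd → ℂ,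
      (Matrix.of fun row k : Fin r => ∏ a ∈ u row,
        (tx (e k).1 none a + ∑ f : Fin D, ((e k).2 f).elim 0 fun j => tx (e k).1 (some (f, j)) a)).det = 0) :
    ¬ W hd r e := by
  intro hW
  obtain ⟨tx, htx⟩ := exists_simplexTable_of_boxWinning_layerCake W hwin e hW u hu hlow
  exact htx (hsing tx)

/-- **THE DIMENSION LAW, every `t` (layer-cake floor).** As `not_boxWinning_hypercube`, for the sharp-floor box game of p656478
(`t = 1, 2`: p658056 `not_boxWinning_rect_layerCake`, p659328 `not_boxWinning_cube_layerCake`). -/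
theorem not_boxWinning_hypercube_layerCake {m D N : ℕ}
    (W : (hd : ℕ) → (r : ℕ) → (Fin r → Fin m × (Fin D → Option (Fin N))) → Prop)
    (hwin : ∀ (hd r : ℕ) (e : Fin r → Fin m × (Fin D → Option (Fin N))), W hd r e → 2 ≤ r → 1 ≤ hd →
      ∀ r₀ r₁ : ℕ, r₀ + r₁ = r →
        (∑ d ∈ Finset.range hd, (r - ∑ j ∈ Finset.range (d + 1), hd.choose j) + hd - 1) / hd ≤ r₁ → r₁ ≤ r₀ →
        r₀ ≤ 2 ^ (hd - 1) →
        ∃ (f : Fin m → Fin D) (side : Fin m → Option (Fin N) → Bool) (g₀ : Fin r₀ → Fin r) (g₁ : Fin r₁ → Fin r),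
          Function.Injective (Sum.elim g₀ g₁) ∧
          (∀ j, side (e (g₀ j)).1 ((e (g₀ j)).2 (f (e (g₀ j)).1)) = false) ∧
          (∀ j, side (e (g₁ j)).1 ((e (g₁ j)).2 (f (e (g₁ j)).1)) = true) ∧
          W (hd - 1) r₀ (fun j => e (g₀ j)) ∧ W (hd - 1) r₁ (fun j => e (g₁ j)))
    (t : ℕ) :
    ∀ (r hd : ℕ) (e : Fin r → Fin m × (Fin D → Option (Fin N))) (i : (Fin (t + 1) → Fin 2) → Fin r),
      r ≤ ∑ j ∈ Finset.range (t + 1), hd.choose j → Function.Injective i →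
      (∀ z, (e (i z)).1 = (e (i fun _ => 0)).1) →
      (∀ φ : Fin D, ∃ c : Fin (t + 1), ∀ z z', z c = z' c → (e (i z)).2 φ = (e (i z')).2 φ) →
      ¬ W hd r e := by
  intro r hd e i hr hinj hpiece hcube
  obtain ⟨u, hu, hlow, hut⟩ := exists_lower_family_card_le hd t r hr
  exact not_boxWinning_of_singular_layerCake W hwin hd r e u hu hlow
    (fun tx => det_simplexMatrix_eq_zero_of_cube u hut e i hinj hpiece hcube tx)

end

end Summit.ValiantsHypothesis.ValiantsHypothesis.Theorems.BarrierLever.SimplexJoin.Cut
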